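import Summits.BirchSwinnertonDyer.BirchSwinnertonDyer.Theorems.EisensteinPrimesMazurMCOnX1RankZeroInterludeResidualGL1EvenCore
import Summits.BirchSwinnertonDyer.BirchSwinnertonDyer.Theorems.EisensteinPrimesMazurMCOnX1RankZeroInterludeResidualGL1UnrTransport
import Summits.BirchSwinnertonDyer.BirchSwinnertonDyer.Theorems.EisensteinPrimesMazurMCOnX1RankZeroInterludeResidualGL1Tame
import Literature.NumberTheory.EllipticCurves.H1CorestrictionIndexTwo
import Literature.NumberTheory.EllipticCurves.GreenbergVatsal2000.UnramifiedOutsideFinite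
import Literature.NumberTheory.EllipticCurves.CyclotomicZpExtension
import Literature.NumberTheory.EllipticCurves.ZpExtensionProofs
import Literature.NumberTheory.EllipticCurves.HeegnerPointsImaginaryQuadraticProofs
import Literature.NumberTheory.GaloisRepresentations.AbsIntegersEquiv
import Literature.NumberTheory.GaloisRepresentations.InducedGaloisRep
import Literature.NumberTheory.GaloisRepresentations.ArtinFormalismInductionProofs
import HarnessLib

/-!
# Crux `MazurMCOnX1RankZero` (item stmt-BirchSwinnertonDyer-19035), line `interlude_with_torsion`, road B input [Even] FROM GREENBERG'S LEMMA 5.9: parity on prime-order modules, continuity upgrade, the quadratic twist `M ⊗ ε_K` (§6–§8)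

Cell `bsd-eis` (host `run/shared/lean/pub/bsd-eis/`), LEAD `cruxlead-19035` (g0); `--supports` stmt-BirchSwinnertonDyer-19035 as a HELPER.
Part of the move of the ideator bsd-idea-11 g17's workfile `Cruxes/MazurMCOnX1RankZero/Lines/interlude_roadB_EvenTransport_idea11g17.lean`
(sorry-free; mathematics by that seat, verbatim; split at the 400-line limit into `…InterludeResidualGL1Even{IndexTwo,Core,Twist,}`) into `Theorems/`,
so that the registered stub `stub_greenbergEvenInput` of skeleton v10 ([Even] = Greenberg, LNM 1716, §5 Lemma 5.9 read over `K_∞ ⊃ ℚ_∞`) is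
closed MODULO the PUBLISHED named fact `Literature.NumberTheory.IwasawaTheory.greenberg1999_lemma59_even_finite` (p693821). HONEST FRAMING:
kernel plumbing (inflation–restriction along the index-2 pair `res(ker κ_K) ⊲ ker κ_ℚ`, corestriction, the quadratic twist `M ⊗ ε_K`);
nothing about BSD, Mazur's main conjecture or IMC2 is asserted; Greenberg's Lemma 5.9 itself is NOT proved (named fact).
Contents: §6 modules of prime order (parity of an involution, conjugate elements act alike; the scalar lemmas are the tree's `UnrTransport.*`);
§7 continuity of a Galois action restricted along an open embedding; §8 the quadratic twist `M ⊗ ε_K` (same `Γ_K`-module) and its `H¹` casts.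
[cite: Greenberg1999LNM, §5 Lemma 5.9 and proof of Prop. 5.10] [cite: SerreGaloisCohomology1997, I §2.4, I §5.8] [cite: GreenbergVatsal2000, §2]
-/

noncomputable section

set_option linter.dupNamespace false
set_option autoImplicit false

open scoped NumberField Pointwise
open Field IsDedekindDomain
open Literature.NumberTheory.GaloisRepresentations
open Literature.NumberTheory.EllipticCurves Literature.NumberTheory.EllipticCurves.GreenbergSelmer
open Literature.NumberTheory.EllipticCurves.GreenbergVatsal2000

namespace Summit.BirchSwinnertonDyer.BirchSwinnertonDyer.Theorems.InterludeWithTorsion.EvenTransport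
/-! ## §6 Modules of prime order: integer scalars, parity of an involution, conjugate elements act alike -/

section PrimeOrder

variable {Γ : Type} [Group Γ] {M : Type} [AddCommGroup M] [DistribMulAction Γ M]

omit [Group Γ] [DistribMulAction Γ M] in
/-- Integers divisible by `#M` kill `M`. [folklore] -/
theorem zsmul_eq_zero_of_natCard_dvd {n : ℤ} (h : (Nat.card M : ℤ) ∣ n) (m : M) : n • m = 0 :=
  addOrderOf_dvd_iff_zsmul_eq_zero.mp ((Int.natCast_dvd_natCast.mpr (addOrderOf_dvd_natCard m)).trans h)

/-- **An involution acts on a module of prime order by `+1` or by `-1`** (its scalar `k` has `k² ≡ 1 (mod p)`).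
[folklore] -/
theorem smul_eq_self_or_eq_neg {p : ℕ} [Fact p.Prime] (hcard : Nat.card M = p) {g : Γ} (hg : g * g = 1) :
    (∀ m : M, g • m = m) ∨ (∀ m : M, g • m = -m) := by
  have hp : p.Prime := Fact.out
  obtain ⟨k, hk⟩ := UnrTransport.exists_int_forall_smul_eq hcard g
  obtain ⟨m₀, hm₀, -⟩ := UnrTransport.exists_forall_exists_zsmul_eq (M := M) hcard
  have hkk : ∀ m : M, (k * k) • m = m := fun m ↦ by
    have h1 : (g * g) • m = m := by rw [hg, one_smul]
    rw [mul_smul, hk m, smul_comm g k m, hk m, smul_smul] at h1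
    exact h1
  have hdiv : (p : ℤ) ∣ (k - 1) * (k + 1) := by
    have h0 : (k * k - 1) • m₀ = 0 := by rw [sub_zsmul, one_zsmul, hkk]; simp
    have ho : addOrderOf m₀ = p := by
      rcases hp.eq_one_or_self_of_dvd _ (hcard ▸ addOrderOf_dvd_natCard m₀) with h | h
      · exact absurd (AddMonoid.addOrderOf_eq_one_iff.mp h) hm₀
      · exact h
    have := addOrderOf_dvd_iff_zsmul_eq_zero.mpr h0
    rw [ho] at this
    rwa [show (k - 1) * (k + 1) = k * k - 1 by ring]
  rcases (Nat.prime_iff_prime_int.mp hp).dvd_or_dvd hdiv with h | h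
  · left
    intro m
    have h0 : (k - 1) • m = 0 := zsmul_eq_zero_of_natCard_dvd (by rwa [hcard]) m
    calc g • m = k • m := hk m
      _ = ((k - 1) + 1) • m := by congr 1; ring
      _ = m := by rw [add_zsmul, one_zsmul, h0]; simp
  · right
    intro m
    have h0 : (k + 1) • m = 0 := zsmul_eq_zero_of_natCard_dvd (by rwa [hcard]) m
    calc g • m = k • m := hk m
      _ = ((k + 1) - 1) • m := by congr 1; ring
      _ = -m := by rw [sub_zsmul, one_zsmul, h0]; simp

/-- **Conjugate elements act alike on a module of prime order** (the action is through the abelian group of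
scalars). [folklore] -/
theorem smul_eq_smul_of_isConj {p : ℕ} [Fact p.Prime] (hcard : Nat.card M = p) {g g' : Γ} (h : IsConj g g') (m : M) :
    g' • m = g • m := by
  obtain ⟨d, rfl⟩ := isConj_iff.mp h
  obtain ⟨k, hk⟩ := UnrTransport.exists_int_forall_smul_eq hcard g
  rw [mul_smul, mul_smul, hk, smul_comm d k, smul_inv_smul, hk]

end PrimeOrder

/-! ## §7 Continuity of a Galois action restricted along an open embedding (`Γ_K`-continuity ⟹ `Γ_ℚ`-continuity) -/

section Upgrade

variable {G G' : Type} [Group G] [Group G'] [TopologicalSpace G] [TopologicalSpace G']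
  {M : Type} [MulAction G M] [TopologicalSpace M] [DiscreteTopology M]

/-- An orbit map `σ ↦ σ • m` into a DISCRETE space is continuous as soon as the stabiliser of `m` is open. [folklore] -/
theorem continuous_smul_of_isOpen_stabilizer [IsTopologicalGroup G] (m : M)
    (h : IsOpen ((MulAction.stabilizer G m : Subgroup G) : Set G)) : Continuous fun σ : G ↦ σ • m := by
  rw [continuous_discrete_rng]
  intro b
  by_cases hb : ∃ σ₀ : G, σ₀ • m = b
  · obtain ⟨σ₀, rfl⟩ := hb
    have hset : (fun σ : G ↦ σ • m) ⁻¹' {σ₀ • m} = (fun σ : G ↦ σ₀⁻¹ * σ) ⁻¹' (MulAction.stabilizer G m : Set G) := by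
      ext σ
      simp only [Set.mem_preimage, Set.mem_singleton_iff, SetLike.mem_coe, MulAction.mem_stabilizer_iff, mul_smul,
        inv_smul_eq_iff]
    rw [hset]
    exact h.preimage (continuous_const.mul continuous_id)
  · have hset : (fun σ : G ↦ σ • m) ⁻¹' {b} = ∅ := by
      ext σ
      simp only [Set.mem_preimage, Set.mem_singleton_iff, Set.mem_empty_iff_false, iff_false]
      exact fun hσ ↦ hb ⟨σ, hσ⟩
    rw [hset]
    exact isOpen_empty

/-- The stabiliser of `m` is open when the orbit map is continuous (discrete `M`). [folklore] -/
theorem isOpen_stabilizer_of_continuous_smul (m : M) (h : Continuous fun σ : G ↦ σ • m) :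
    IsOpen ((MulAction.stabilizer G m : Subgroup G) : Set G) := by
  have : ((MulAction.stabilizer G m : Subgroup G) : Set G) = (fun σ : G ↦ σ • m) ⁻¹' {m} := by
    ext σ; simp
  rw [this]
  exact (isOpen_discrete {m}).preimage h

/-- **Continuity of an action descends along an open embedding of groups**: `f : G' → G` an open embedding of
topological groups, `G` acting on a discrete `M` and `G'` through `f` with continuous orbit maps; then the `G`-orbit maps are
continuous (the `G`-stabiliser contains the open set `f(Stab_{G'}(m)) ∋ 1`). [cite: NeukirchANT1999, Ch. IV §1] [folklore] -/
theorem continuous_smul_of_isOpenEmbedding [IsTopologicalGroup G] [MulAction G' M] (f : G' →* G)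
    (hemb : Topology.IsOpenEmbedding f) (hprov : ∀ (σ : G') (m : M), σ • m = f σ • m)
    (hcont : ∀ m : M, Continuous fun σ : G' ↦ σ • m) (m : M) : Continuous fun τ : G ↦ τ • m := by
  refine continuous_smul_of_isOpen_stabilizer m ?_
  have hS' : IsOpen ((MulAction.stabilizer G' m : Subgroup G') : Set G') :=
    isOpen_stabilizer_of_continuous_smul m (hcont m)
  have himg : IsOpen (f '' ((MulAction.stabilizer G' m : Subgroup G') : Set G')) := hemb.isOpenMap _ hS'
  have hsub : f '' ((MulAction.stabilizer G' m : Subgroup G') : Set G') ⊆ (MulAction.stabilizer G m : Set G) := by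
    rintro _ ⟨σ, hσ, rfl⟩
    rw [SetLike.mem_coe, MulAction.mem_stabilizer_iff] at hσ ⊢
    rw [← hprov, hσ]
  have h1 : (1 : G) ∈ f '' ((MulAction.stabilizer G' m : Subgroup G') : Set G') := ⟨1, by simp, map_one f⟩
  exact Subgroup.isOpen_of_mem_nhds _ (Filter.mem_of_superset (himg.mem_nhds h1) hsub)

/-- **`Γ_K`-continuity ⟹ `Γ_ℚ`-continuity for a restricted Galois action** (`res : Γ_K → Γ_ℚ` is an open embedding,
`isOpenEmbedding_absGaloisRestrict`). [cite: NeukirchANT1999, Ch. IV §1] [folklore] -/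
theorem continuous_smul_of_continuous_restrict (K : Type) [Field K] [NumberField K] {X : Type} [TopologicalSpace X]
    [DiscreteTopology X] [MulAction (absoluteGaloisGroup ℚ) X] [MulAction (absoluteGaloisGroup K) X]
    (hprov : ∀ (σ : absoluteGaloisGroup K) (x : X), σ • x = absGaloisRestrict ℚ K σ • x)
    (hcont : ∀ x : X, Continuous fun σ : absoluteGaloisGroup K ↦ σ • x) (x : X) :
    Continuous fun τ : absoluteGaloisGroup ℚ ↦ τ • x :=
  continuous_smul_of_isOpenEmbedding (absGaloisRestrict ℚ K).toMonoidHom (isOpenEmbedding_absGaloisRestrict ℚ K) hprov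
    hcont x

end Upgrade

/-! ## §8 The quadratic twist `M ⊗ ε_K` of the `Γ_ℚ`-module `M` (same `Γ_K`-module) -/

section TwistDef

set_option linter.unusedVariables false in
/-- **`Twist K M = M ⊗ ε_K`**: the abelian group `M` with the SAME `Γ_K`-action and the `Γ_ℚ`-action multiplied by the
quadratic character `ε_K` of `Γ_ℚ / res(Γ_K)` (`g • x = g • x` for `g ∈ res(Γ_K)`, `= -(g • x)` otherwise); `K` is a
phantom parameter of the type. [folklore] -/
def Twist (K : Type) (M : Type) : Type := M

namespace Twist

section Bare

variable {K : Type} {M : Type}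

/-- `M → Twist K M`. [folklore] -/
def of (m : M) : Twist K M := m

/-- `Twist K M → M`. [folklore] -/
def val (x : Twist K M) : M := x

/-- Auxiliary (theorem `val_of`) of the quadratic-twist / transport bookkeeping; see the module docstring. [folklore] -/
@[simp] theorem val_of (m : M) : val (of (K := K) m) = m := rfl

/-- Auxiliary theorem of the quadratic-twist / transport bookkeeping; see the module docstring. [folklore] -/
@[simp] theorem of_val (x : Twist K M) : of x.val = x := rfl

/-- `#(Twist K M) = #M`. [folklore] -/
theorem natCard_eq : Nat.card (Twist K M) = Nat.card M := rfl

/-- Auxiliary (instance `instance`) of the quadratic-twist / transport bookkeeping; see the module docstring. [folklore] -/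
instance [AddCommGroup M] : AddCommGroup (Twist K M) := inferInstanceAs (AddCommGroup M)
/-- Auxiliary (instance `instance`) of the quadratic-twist / transport bookkeeping; see the module docstring. [folklore] -/
instance [TopologicalSpace M] : TopologicalSpace (Twist K M) := inferInstanceAs (TopologicalSpace M)
/-- Auxiliary (instance `instance`) of the quadratic-twist / transport bookkeeping; see the module docstring. [folklore] -/
instance [TopologicalSpace M] [DiscreteTopology M] : DiscreteTopology (Twist K M) :=
  inferInstanceAs (DiscreteTopology M)

end Bare

variable {K : Type} [Field K] [NumberField K] {M : Type}

/-- Auxiliary (instance `instance`) of the quadratic-twist / transport bookkeeping; see the module docstring. [folklore] -/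
instance instDistribMulActionK [AddCommGroup M] [DistribMulAction (absoluteGaloisGroup K) M] :
    DistribMulAction (absoluteGaloisGroup K) (Twist K M) :=
  inferInstanceAs (DistribMulAction (absoluteGaloisGroup K) M)

section Range

/-- `1 ∈ res(Γ_K)`. [folklore] -/
theorem one_mem_range : (1 : absoluteGaloisGroup ℚ) ∈ Set.range (absGaloisRestrict ℚ K) := ⟨1, map_one _⟩

/-- `res(Γ_K)` is closed under products. [folklore] -/
theorem mul_mem_range {a b : absoluteGaloisGroup ℚ} (ha : a ∈ Set.range (absGaloisRestrict ℚ K))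
    (hb : b ∈ Set.range (absGaloisRestrict ℚ K)) : a * b ∈ Set.range (absGaloisRestrict ℚ K) := by
  obtain ⟨x, rfl⟩ := ha
  obtain ⟨y, rfl⟩ := hb
  exact ⟨x * y, map_mul _ _ _⟩

/-- `res(Γ_K)` is closed under inverses. [folklore] -/
theorem inv_mem_range {a : absoluteGaloisGroup ℚ} (ha : a ∈ Set.range (absGaloisRestrict ℚ K)) :
    a⁻¹ ∈ Set.range (absGaloisRestrict ℚ K) := by
  obtain ⟨x, rfl⟩ := ha
  exact ⟨x⁻¹, map_inv _ _⟩

/-- For `[K : ℚ] = 2`, the product of two non-members of `res(Γ_K)` is a member. [folklore] -/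
theorem mul_mem_range_of_not_mem [Fact (Module.finrank ℚ K = 2)] {a b : absoluteGaloisGroup ℚ}
    (ha : a ∉ Set.range (absGaloisRestrict ℚ K)) (hb : b ∉ Set.range (absGaloisRestrict ℚ K)) :
    a * b ∈ Set.range (absGaloisRestrict ℚ K) := by
  have := inv_mul_mem_range_absGaloisRestrict (Fact.out : Module.finrank ℚ K = 2) (inv_not_mem_range ha) hb
  rwa [inv_inv] at this

/-- `(member) * (non-member)` is a non-member. [folklore] -/
theorem mul_not_mem_range_left {a b : absoluteGaloisGroup ℚ} (ha : a ∈ Set.range (absGaloisRestrict ℚ K))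
    (hb : b ∉ Set.range (absGaloisRestrict ℚ K)) : a * b ∉ Set.range (absGaloisRestrict ℚ K) := fun h ↦ hb (by
  have := mul_mem_range (inv_mem_range ha) h
  rwa [inv_mul_cancel_left] at this)

/-- `(non-member) * (member)` is a non-member. [folklore] -/
theorem mul_not_mem_range_right {a b : absoluteGaloisGroup ℚ} (ha : a ∉ Set.range (absGaloisRestrict ℚ K))
    (hb : b ∈ Set.range (absGaloisRestrict ℚ K)) : a * b ∉ Set.range (absGaloisRestrict ℚ K) := fun h ↦ ha (by
  have := mul_mem_range h (inv_mem_range hb)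
  rwa [mul_inv_cancel_right] at this)

end Range

variable [AddCommGroup M] [DistribMulAction (absoluteGaloisGroup ℚ) M]

open Classical in
/-- The twisted `Γ_ℚ`-action on `Twist K M` (bare `SMul`). [folklore] -/
instance instSMulQ : SMul (absoluteGaloisGroup ℚ) (Twist K M) :=
  ⟨fun g x ↦ if g ∈ Set.range (absGaloisRestrict ℚ K) then of (g • x.val) else of (-(g • x.val))⟩

open Classical in
/-- Auxiliary (theorem `smul_def`) of the quadratic-twist / transport bookkeeping; see the module docstring. [folklore] -/
theorem smul_def (g : absoluteGaloisGroup ℚ) (x : Twist K M) :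
    g • x = if g ∈ Set.range (absGaloisRestrict ℚ K) then of (g • x.val) else of (-(g • x.val)) := rfl

/-- The twisted action on `res(Γ_K)`. [folklore] -/
theorem smul_of_mem {g : absoluteGaloisGroup ℚ} (hg : g ∈ Set.range (absGaloisRestrict ℚ K)) (x : Twist K M) :
    g • x = of (g • x.val) := by
  rw [smul_def, if_pos hg]

/-- The twisted action off `res(Γ_K)`. [folklore] -/
theorem smul_of_not_mem {g : absoluteGaloisGroup ℚ} (hg : g ∉ Set.range (absGaloisRestrict ℚ K)) (x : Twist K M) :
    g • x = of (-(g • x.val)) := by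
  rw [smul_def, if_neg hg]

/-- **`Twist K M` is a `Γ_ℚ`-module** (`[K : ℚ] = 2`: `res(Γ_K)` has index `2`). [folklore] -/
instance instDistribMulActionQ [Fact (Module.finrank ℚ K = 2)] : DistribMulAction (absoluteGaloisGroup ℚ) (Twist K M) where
  one_smul x := by rw [smul_of_mem one_mem_range, one_smul, of_val]
  mul_smul g h x := by
    by_cases hg : g ∈ Set.range (absGaloisRestrict ℚ K) <;> by_cases hh : h ∈ Set.range (absGaloisRestrict ℚ K)
    · rw [smul_of_mem (mul_mem_range hg hh), smul_of_mem hh, smul_of_mem hg, val_of, mul_smul]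
    · rw [smul_of_not_mem (mul_not_mem_range_left hg hh), smul_of_not_mem hh, smul_of_mem hg, val_of, mul_smul, smul_neg]
    · rw [smul_of_not_mem (mul_not_mem_range_right hg hh), smul_of_mem hh, smul_of_not_mem hg, val_of, mul_smul]
    · rw [smul_of_mem (mul_mem_range_of_not_mem hg hh), smul_of_not_mem hh, smul_of_not_mem hg, val_of, mul_smul,
        smul_neg, neg_neg]
  smul_zero g := by
    by_cases hg : g ∈ Set.range (absGaloisRestrict ℚ K)
    · rw [smul_of_mem hg, show (0 : Twist K M).val = 0 from rfl, smul_zero]; rfl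
    · rw [smul_of_not_mem hg, show (0 : Twist K M).val = 0 from rfl, smul_zero, neg_zero]; rfl
  smul_add g x y := by
    by_cases hg : g ∈ Set.range (absGaloisRestrict ℚ K)
    · rw [smul_of_mem hg, smul_of_mem hg, smul_of_mem hg, show (x + y).val = x.val + y.val from rfl, smul_add]; rfl
    · rw [smul_of_not_mem hg, smul_of_not_mem hg, smul_of_not_mem hg, show (x + y).val = x.val + y.val from rfl,
        smul_add, neg_add]; rfl

variable [DistribMulAction (absoluteGaloisGroup K) M]

omit [NumberField K] [DistribMulAction (absoluteGaloisGroup ℚ) M] in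
/-- The `Γ_K`-action on `Twist K M` is the one of `M`. [folklore] -/
theorem smul_val_K (σ : absoluteGaloisGroup K) (x : Twist K M) : (σ • x).val = σ • x.val := rfl

/-- **Compatibility `σ • x = res σ • x` survives the twist.** [folklore] -/
theorem compat (hM : ∀ (σ : absoluteGaloisGroup K) (m : M), σ • m = absGaloisRestrict ℚ K σ • m)
    (σ : absoluteGaloisGroup K) (x : Twist K M) : σ • x = absGaloisRestrict ℚ K σ • x := by
  rw [smul_of_mem ⟨σ, rfl⟩, ← hM]
  rfl

omit [DistribMulAction (absoluteGaloisGroup K) M] in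
/-- **An element acting by `-1` on `M` and lying off `res(Γ_K)` acts trivially on `Twist K M`.** [folklore] -/
theorem smul_eq_self_of_not_mem {c : absoluteGaloisGroup ℚ} (hodd : ∀ m : M, c • m = -m)
    (hc : c ∉ Set.range (absGaloisRestrict ℚ K)) (x : Twist K M) : c • x = x := by
  rw [smul_of_not_mem hc, hodd, neg_neg, of_val]

section H1

variable [TopologicalSpace M] [DiscreteTopology M] (H : Subgroup (absoluteGaloisGroup K))

omit [NumberField K] [DistribMulAction (absoluteGaloisGroup ℚ) M] in
/-- **`H¹(H, Twist K M) = H¹(H, M)`** for `H ≤ Γ_K` (the `H`-modules coincide): the identity, typed. [folklore] -/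
def h1Cast : subgroupH1 H (Twist K M) →+ subgroupH1 H M := AddMonoidHom.id (subgroupH1 H M)

omit [NumberField K] [DistribMulAction (absoluteGaloisGroup ℚ) M] in
/-- The inverse identification `H¹(H, M) = H¹(H, Twist K M)`. [folklore] -/
def h1CastInv : subgroupH1 H M →+ subgroupH1 H (Twist K M) := AddMonoidHom.id (subgroupH1 H M)

omit [NumberField K] [DistribMulAction (absoluteGaloisGroup ℚ) M] in
/-- Auxiliary (theorem `h1Cast_h1CastInv`) of the quadratic-twist / transport bookkeeping; see the module docstring. [folklore] -/
@[simp] theorem h1Cast_h1CastInv (x : subgroupH1 H M) : h1Cast H (h1CastInv H x) = x := rfl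

omit [NumberField K] [DistribMulAction (absoluteGaloisGroup ℚ) M] in
/-- Auxiliary theorem of the quadratic-twist / transport bookkeeping; see the module docstring. [folklore] -/
@[simp] theorem h1CastInv_h1Cast (x : subgroupH1 H (Twist K M)) : h1CastInv H (h1Cast H x) = x := rfl

omit [NumberField K] [DistribMulAction (absoluteGaloisGroup ℚ) M] in
/-- `Z¹(H, Twist K M) = Z¹(H, M)`: the identity, typed. [folklore] -/
def cocycleCast : contOneCocycles (discreteTopRep H (Twist K M)) →+ contOneCocycles (discreteTopRep H M) :=
  AddMonoidHom.id (contOneCocycles (discreteTopRep H M))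

omit [NumberField K] [DistribMulAction (absoluteGaloisGroup ℚ) M] in
/-- `Z¹(H, M) = Z¹(H, Twist K M)`: the identity, typed. [folklore] -/
def cocycleCastInv : contOneCocycles (discreteTopRep H M) →+ contOneCocycles (discreteTopRep H (Twist K M)) :=
  AddMonoidHom.id (contOneCocycles (discreteTopRep H M))

omit [NumberField K] [DistribMulAction (absoluteGaloisGroup ℚ) M] in
/-- Auxiliary (theorem `cocycleCast_apply`) of the quadratic-twist / transport bookkeeping; see the module docstring. [folklore] -/
theorem cocycleCast_apply (w : contOneCocycles (discreteTopRep H (Twist K M))) (σ : H) :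
    (cocycleCast H w).1 σ = Twist.val (K := K) (w.1 σ) := rfl

omit [NumberField K] [DistribMulAction (absoluteGaloisGroup ℚ) M] in
/-- Auxiliary (theorem `cocycleCastInv_apply`) of the quadratic-twist / transport bookkeeping; see the module docstring. [folklore] -/
theorem cocycleCastInv_apply (z : contOneCocycles (discreteTopRep H M)) (σ : H) :
    (cocycleCastInv H z).1 σ = Twist.of (K := K) (z.1 σ) := rfl

omit [NumberField K] [DistribMulAction (absoluteGaloisGroup ℚ) M] in
/-- Auxiliary (theorem `h1Cast_oneCocycleClass`) of the quadratic-twist / transport bookkeeping; see the module docstring. [folklore] -/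
theorem h1Cast_oneCocycleClass (w : contOneCocycles (discreteTopRep H (Twist K M))) :
    h1Cast H (oneCocycleClass (discreteTopRep H (Twist K M)) w) = oneCocycleClass (discreteTopRep H M) (cocycleCast H w) :=
  AddMonoidHom.id_apply (subgroupH1 H M) _

omit [NumberField K] [DistribMulAction (absoluteGaloisGroup ℚ) M] in
/-- Auxiliary (theorem `h1CastInv_oneCocycleClass`) of the quadratic-twist / transport bookkeeping; see the module docstring. [folklore] -/
theorem h1CastInv_oneCocycleClass (z : contOneCocycles (discreteTopRep H M)) :
    h1CastInv H (oneCocycleClass (discreteTopRep H M) z) =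
      oneCocycleClass (discreteTopRep H (Twist K M)) (cocycleCastInv H z) :=
  AddMonoidHom.id_apply (subgroupH1 H M) _

end H1

end Twist

end TwistDef

end Summit.BirchSwinnertonDyer.BirchSwinnertonDyer.Theorems.InterludeWithTorsion.EvenTransport
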